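import Literature.NumberTheory.Automorphic.CDTTheorem722SerreLevelProofs
import Literature.NumberTheory.EllipticCurves.TorsionLevelLoweringGoodReductionProofs
import Literature.NumberTheory.EllipticCurves.MultiplicativeTransvectionPrimeToVProofs
import HarnessLib

/-!
# Stub-ideation k = 1, GENERATION 18 (home family 1 = RECOGNISE & IMPORT) for `stub_liftThree`
# of crux `FreyModularity` (stmt-ABC-11340, route ABC/DefiniteXi, `Lines/Sketch.lean`, sha 21576c53)

Companion of `STUB-IDEAS-stub_liftThree-1.md` (gen 18), §2: **the tree's own SERRE ROAD
(`CDTTheorem722SerreProofs`, `CDTTheorem722SerreLevelProofs`, landed 2026-08-15, all theorems PROVED)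
imported to the stub's Tate-form conclusion `W.IsModularGaloisRepTate 3`** — for EVERY elliptic `W/ℚ`
and every prime `ℓ`, discarding all four hypotheses of the stub — with terminal named fact
`khare_wintenberger p k` for all large `p` (`KWLarge`) and NOTHING ELSE: no `R = T` at `3`, no
Langlands–Tunnell, no Eichler–Shimura / Faltings / Carayol (those enter the tree's road only in its last
step `IsModular W`, which the stub does not need), no Ogg–Saito (the road needs only a BOUND on the
Serre level, which the tree's `ℓ`-independence of the Artin conductor supplies).

Helper STATEMENTS (each one prover cycle; `def … : Prop`, no `sorry`):
* `RamMult`, `RamMultLevel` (H18.1a/b) — multiplicative sibling of the tree's PROVED additive lemmas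
  `IsTorsionGaloisRep.exists_mem_inertia_apply_ne_one_of_hasAdditiveReductionAt` /
  `dvd_of_isGaloisRepOfNewform1Int_of_hasAdditiveReductionAt` (`TorsionLevelLoweringGoodReductionProofs`,
  2026-08-28), by transport of the PROVED local lemma
  `exists_inertia_smul_ne_of_hasMultiplicativeReductionAt_of_not_dvd` (`MultiplicativeTransvectionPrimeToVProofs`,
  2026-08-25).  (Also discharges the only `sorry` of `STUB_IDEAS_stub_liftFive_3g15.lean`, "H-RAM".)
* `LevelBound` (H18.2) — `N(ρ̄_{E,p} ⊗ k) ≤ M_E` for `p > N_E`, from the PROVED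
  `IsTorsionGaloisRep.serreLevel_baseChange_dvd_conductorNatOf` and the PROVED `ℓ`-independence
  `artinConductorAt_rationalTate_eq_artinConductorAt_rationalTate{,_of_notMem_two}`
  (`HasseWeilAbelianConductorSwanIndependence{,Two}Proofs`); no conductor fact.
* `SerreInput` (H18.3) — the hypothesis of the tree's Serre Théorème 4
  (`isModular_of_forall_isTorsionGaloisRep_exists_isNewform1_of_three_facts`) WITH the extra conjunct
  "every bad prime divides the level", from `KWLarge`: clone of the PROVED
  `forall_isTorsionGaloisRep_exists_isNewform1_of_khare_wintenberger` taking the CANONICAL local datum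
  above `p` (weight `2` is then the PROVED `serreWeight_eq_two_of_hasGoodReductionAt`, pattern of
  `exists_isNewform1_two_dvd_serreLevel_of_hasGoodReductionAtPrime` Step 3), `hlev` replaced by H18.2,
  bad primes by H18.1b + the additive tree lemma.
* `Pigeonhole` (H18.4) — Steps 0–5 of the PROVED proof of Serre's Théorème 4 (Part E of
  `CDTTheorem722SerreProofs`), verbatim, Step 6 (the three classical facts) deleted, the bad-prime
  conjunct threaded through the infinite fibre.
* `TateOut` (H18.5) — clone of the PROVED `IsModular.isModularGaloisRepTate` (`CDTTheorem722`) for a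
  `Γ₀(N)`-newform matching `a_q(E)` off `N` with every bad prime dividing `N`; coefficient embedding
  `ι : K_g → \bar ℚ_ℓ` by `IsAlgClosed.lift` (`IsNewform1.finiteDimensional_coeffCharField`, PROVED)
  instead of `K_g = ℚ`.

Kernel status: NO `sorry`; helper STATEMENTS are `def … : Prop`; the assembly
`isModularGaloisRepTate_of_serreRoad` / `liftThree_of_serreRoad` is PROVED (modus ponens — all the
mathematics sits in the five helper statements, whose proofs are clones of PROVED tree theorems).
-/

noncomputable section

open scoped MatrixGroups Matrix NumberField ModularForm Polynomial
open NumberField IsDedekindDomain IsDedekindDomain.HeightOneSpectrum CongruenceSubgroup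
open Literature.NumberTheory Literature.NumberTheory.Automorphic Literature.NumberTheory.Automorphic.BCDT
open Literature.NumberTheory.GaloisRepresentations Literature.NumberTheory.GaloisRepresentations.ModPGaloisRep
open Literature.NumberTheory.EllipticCurves Literature.NumberTheory.EllipticCurves.ModularForms
open Literature.NumberTheory.GaloisRepresentations.IsNonarchimedeanLocalField
open WeierstrassCurve Rat.HeightOneSpectrum Field ValuativeRel

set_option linter.dupNamespace false

namespace Summit.ABC.ABC.Cruxes.FreyModularity.StubIdeas.LiftThree1g18

/-! ## §0 The stub, verbatim -/

/-- `stub_liftThree` of `Lines/Sketch.lean` (sha 21576c53), VERBATIM. [cite: Diamond1996, Thm. 5.4] -/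
def LiftThree : Prop :=
  ∀ (W : WeierstrassCurve ℚ) [W.IsElliptic] (ρ : ModPGaloisRep ℚ (ZMod 3) 2),
    W.IsTorsionGaloisRep 3 ρ → ρ.IsAbsIrreducibleOverSqrt (-3) → ¬ 9 ∣ W.conductorNorm ℤ →
    ρ.IsModular → W.IsModularGaloisRepTate 3

/-- The stronger, hypothesis-free target the Serre road actually reaches: BCDT condition (4) for every
elliptic curve over `ℚ` and every prime `ℓ`. [cite: BCDTJAMS2001, Introduction (condition (4))] -/
def TateModularAll : Prop :=
  ∀ (W : WeierstrassCurve ℚ) [W.IsElliptic] (ℓ : ℕ) [Fact ℓ.Prime], W.IsModularGaloisRepTate ℓ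

/-- `TateModularAll → stub_liftThree` (the four hypotheses are discarded). [folklore] -/
theorem liftThree_of_tateModularAll (h : TateModularAll) : LiftThree :=
  fun W _ _ _ _ _ _ ↦ h W 3

/-! ## §1 The terminal named fact: Khare–Wintenberger for all large `p` -/

/-- **The one named-fact debt of the road**: Serre's conjecture (3.2.4) at every prime `p ≥ p₀`
(tree: `khare_wintenberger p k := SerreModularityConjecture p k`, `Automorphic/SerreConjecture.lean`,
0 producers) — the hypothesis `hKW` of the tree's
`forall_isTorsionGaloisRep_exists_isNewform1_of_khare_wintenberger`, verbatim.
[cite: KhareWintenberger2009, Thm. 1.2, Thm. 9.1, §10 Thm. 10.1] -/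
def KWLarge : Prop :=
  ∃ p₀ : ℕ, ∀ (p : ℕ) [Fact p.Prime], p₀ ≤ p →
    ∀ (k : Type) [Field k] [TopologicalSpace k] [DiscreteTopology k], khare_wintenberger p k

/-! ## §2 Helper statements H18.1–H18.5 -/

/-- **H18.1a `RamMult` (S–M): `ρ̄_{E,p}` is ramified at a multiplicative place `v ∤ p` with
`p ∤ ord_v(Δ_min)`** — the multiplicative sibling of the PROVED
`IsTorsionGaloisRep.exists_mem_inertia_apply_ne_one_of_hasAdditiveReductionAt`; proof = that
theorem's 25 lines with `exists_inertia_smul_ne_of_hasMultiplicativeReductionAt_of_not_dvd hmult hp.out hpv hnd hw h𝔐`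
(PROVED, `MultiplicativeTransvectionPrimeToVProofs`) in place of the additive local lemma.
[cite: SilvermanATAEC1994, V Prop. 6.1 and Exercise 5.13 (b)] [cite: SerreAbelianLadic1968, Ch. IV, A.1.2] -/
def RamMult : Prop :=
  ∀ (W : WeierstrassCurve ℚ) [W.IsElliptic] (v : HeightOneSpectrum (𝓞 ℚ)),
    W.HasMultiplicativeReductionAt v → ∀ (p : ℕ) [Fact p.Prime], (p : 𝓞 ℚ) ∉ v.asIdeal →
    ¬ p ∣ W.ordMinimalDiscriminant v → ∀ (ρ : ModPGaloisRep ℚ (ZMod p) 2), W.IsTorsionGaloisRep p ρ →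
    ∃ 𝔓 ∈ v.primesAbove, ∃ σ ∈ 𝔓.inertia (absoluteGaloisGroup ℚ), ρ σ ≠ 1

/-- **H18.1b `RamMultLevel` (S): a multiplicative prime `q ≠ p` with `p ∤ ord_q(Δ_min)` divides the
level of every newform carrying `E[p] ⊗ k` away from `M p`** — sibling of the PROVED
`dvd_of_isGaloisRepOfNewform1Int_of_hasAdditiveReductionAt` (same 20-line proof, H18.1a for §1 there).
[cite: Serre1987, §1.2, (1.2.1)–(1.2.2); §4.6 Lemme 5 (4.6.3)] -/
def RamMultLevel : Prop :=
  ∀ (W : WeierstrassCurve ℚ) [W.IsElliptic] (p : ℕ) [Fact p.Prime] (ρ : ModPGaloisRep ℚ (ZMod p) 2),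
    W.IsTorsionGaloisRep p ρ → ∀ (k : Type) [Field k] [TopologicalSpace k] (j : ZMod p →+* k)
    (hj : Continuous j) (M : ℕ) [NeZero M] (f : CuspForm (Gamma1 M) 2)
    (ιf : coeffCharIntegers f →+* k),
    IsGaloisRepOfNewform1Int f ιf {ℓ | ℓ ∣ M * p} (FramedRep.baseChange j hj ρ) →
    ∀ (v : HeightOneSpectrum (𝓞 ℚ)), W.HasMultiplicativeReductionAt v →
      ((primesEquiv v : Nat.Primes) : ℕ) ≠ p → ¬ p ∣ W.ordMinimalDiscriminant v →
      ((primesEquiv v : Nat.Primes) : ℕ) ∣ M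

/-- **H18.2 `LevelBound` (S–M): a bound on the Serre level of `ρ̄_{E,p} ⊗ k`, uniform in `p > N_E`**
(`N(ρ̄ ⊗ k) ∣ N^{(p)}(V_p E)` is the PROVED `IsTorsionGaloisRep.serreLevel_baseChange_dvd_conductorNatOf`;
`a_v(V_p E) = a_v(V_{ℓ₀} E)` for `v ∤ p ℓ₀` is the PROVED `ℓ`-independence
`artinConductorAt_rationalTate_eq_artinConductorAt_rationalTate_of_notMem_two` / `…SwanIndependenceTwoProofs`;
take `M = ∏_{v bad} q_v ^ max (a_v(V_2 E), a_v(V_3 E))`).  No Ogg–Saito / conductor fact needed.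
[cite: SerreTate1968, §3] [cite: SilvermanATAEC1994, Thm. IV.10.2 (c)] -/
def LevelBound : Prop :=
  ∀ (W : WeierstrassCurve ℚ) [W.IsElliptic], ∃ M : ℕ, ∀ (p : ℕ) [Fact p.Prime], W.conductorNorm ℤ < p →
    ∀ (ρ : ModPGaloisRep ℚ (ZMod p) 2), W.IsTorsionGaloisRep p ρ →
    ∀ (k : Type) [Field k] [TopologicalSpace k] [DiscreteTopology k] (j : ZMod p →+* k),
      serreLevel p (FramedRep.baseChange j continuous_of_discreteTopology ρ) ≤ M

/-- The hypothesis of the tree's Serre Théorème 4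
(`isModular_of_forall_isTorsionGaloisRep_exists_isNewform1_of_three_facts`, shape verbatim) for one
curve, PLUS the conjunct "every bad prime divides the level `N`". [cite: Serre1987, §4.6, Lemme 5] -/
def SerreInputConclusion (W : WeierstrassCurve ℚ) [W.IsElliptic] : Prop :=
  ∃ M p₁ : ℕ, ∀ (p : ℕ) [Fact p.Prime], p₁ ≤ p →
    ∀ ρ : ModPGaloisRep ℚ (ZMod p) 2, W.IsTorsionGaloisRep p ρ →
      ∃ (N : ℕ) (_ : NeZero N) (_ : N ≤ M) (f : CuspForm (Gamma1 N) 2)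
        (K : Type) (_ : Field K) (_ : CharP K p) (_ : TopologicalSpace K)
        (j : ZMod p →+* K) (ι : coeffCharIntegers f →+* K),
        IsNewform1 f ∧ (∀ q : ℕ, q.Prime → q ∣ W.conductorNorm ℤ → q ∣ N) ∧
          IsGaloisRepOfNewform1Int f ι {q | q ∣ N * p}
            (FramedRep.baseChange j continuous_of_discreteTopology ρ)

/-- **H18.3 `SerreInput` (M): Serre's (3.3.1) for `ρ̄_{E,p}`, `p` large, with bad primes in the level,
from `KWLarge` alone** — clone of the PROVED
`forall_isTorsionGaloisRep_exists_isNewform1_of_khare_wintenberger` (45 lines) with: the canonical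
local datum above `p` (so `hwt` is the PROVED `serreWeight_eq_two_of_hasGoodReductionAt`, `p > N_E`,
`p ≠ 2`); `hlev` replaced by `LevelBound`; the level `N = serreLevel p ρ̄'` contains every additive
prime (`dvd_of_isGaloisRepOfNewform1Int_of_hasAdditiveReductionAt`, PROVED, `p ≥ 3`) and every
multiplicative prime (`RamMultLevel`, `p > max_v ord_v Δ_min`); `q ∣ N_E ⇒ q` bad is
`dvd_conductorNorm_iff_not_hasGoodReductionAt` + the local trichotomy.
[cite: Serre1987, §4.6, proof of Théorème 4 (Lemme 5)] [cite: KhareWintenberger2009, Thm. 1.2] -/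
def SerreInput : Prop :=
  KWLarge → RamMultLevel → LevelBound → ∀ (W : WeierstrassCurve ℚ) [W.IsElliptic], SerreInputConclusion W

/-- **H18.4 `Pigeonhole` (M): Serre's "il n'y a qu'un nombre fini de `F` possibles" + "`A_l = a_l`"**
— Steps 0–5 of the PROVED `isModular_of_forall_isTorsionGaloisRep_exists_isNewform1_of_three_facts`
(190 lines, Part E of `CDTTheorem722SerreProofs`) verbatim, Step 6 deleted; the bad-prime conjunct is
constant on the infinite fibre (`N_p = n₀`), and `q ∤ n₀ ⇒ q ∤ n₀ N_E`.
[cite: Serre1987, §4.6, Théorème 4 and its proof ((4.6.4))] -/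
def Pigeonhole : Prop :=
  ∀ (W : WeierstrassCurve ℚ) [W.IsElliptic], SerreInputConclusion W →
    ∃ (n₀ : ℕ) (_ : NeZero n₀) (g : CuspForm (Gamma0 n₀) 2), IsNewform0 g ∧
      (∀ q : ℕ, q.Prime → q ∣ W.conductorNorm ℤ → q ∣ n₀) ∧
      ∀ q : ℕ, q.Prime → ¬ q ∣ n₀ → cuspCoeff g q = (W.LFunction q : ℂ)

/-- **H18.5 `TateOut` (M): a `Γ₀(N)`-newform with `a_q(g) = a_q(E)` off `N` and every bad prime in `N`
makes `ρ_{E,ℓ}` modular for EVERY `ℓ`** — clone of the PROVED `IsModular.isModularGaloisRepTate`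
(`CDTTheorem722`): `f₁ = liftToGamma1 N 2 g` (`isNewform1_liftToGamma1_iff_holds`, `ε = 1`), witness
level `N`; for `v ∤ N ℓ`, `v` is good (bad primes divide `N`), so inertia is trivial on `T_ℓ E`
(`smul_eq_of_mem_inertia_of_nsmul_eq_zero`) and `char(Frob_v) = X² - a_v X + v`
(`trace_/det_galoisRepTate_frobenius_of_hasGoodReductionAt_holds`); `ι : K_{f₁} → \bar ℚ_ℓ` by
`IsAlgClosed.lift` (`IsNewform1.finiteDimensional_coeffCharField`), `ι(a_v(f₁)) = a_v(E)` by `h`.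
[cite: DiamondShurman2005, Thm. 9.4.1] [cite: BCDTJAMS2001, Introduction ((1) ⇒ (4))] -/
def TateOut : Prop :=
  ∀ (W : WeierstrassCurve ℚ) [W.IsElliptic] (N : ℕ) [NeZero N] (g : CuspForm (Gamma0 N) 2),
    IsNewform0 g → (∀ q : ℕ, q.Prime → q ∣ W.conductorNorm ℤ → q ∣ N) →
    (∀ q : ℕ, q.Prime → ¬ q ∣ N → cuspCoeff g q = (W.LFunction q : ℂ)) →
    ∀ (ℓ : ℕ) [Fact ℓ.Prime], W.IsModularGaloisRepTate ℓ

/-! ## §3 Assembly (PROVED): helpers ⇒ `TateModularAll` ⇒ `stub_liftThree` -/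

/-- **The Serre road to BCDT (4) for every `E/ℚ` and every `ℓ`**, from `KWLarge` and H18.1–H18.5.
[cite: Serre1987, §4.6, Théorème 4] [cite: KhareWintenberger2009, §10, Thm. 10.1 (i)] -/
theorem tateModularAll_of_serreRoad (hKW : KWLarge) (h1 : RamMultLevel) (h2 : LevelBound)
    (h3 : SerreInput) (h4 : Pigeonhole) (h5 : TateOut) : TateModularAll := by
  intro W _ ℓ _
  obtain ⟨n₀, hn₀, g, hg, hbad, hcoef⟩ := h4 W (h3 hKW h1 h2 W)
  exact h5 W n₀ g hg hbad hcoef ℓ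

/-- **`stub_liftThree` along Serre's road** (terminal named fact `KWLarge`; helpers H18.1–H18.5).
[cite: Serre1987, §4.6, Théorème 4] -/
theorem liftThree_of_serreRoad (hKW : KWLarge) (h1 : RamMultLevel) (h2 : LevelBound)
    (h3 : SerreInput) (h4 : Pigeonhole) (h5 : TateOut) : LiftThree :=
  liftThree_of_tateModularAll (tateModularAll_of_serreRoad hKW h1 h2 h3 h4 h5)

/-- Dividend 1: the same road closes `stub_liftFive` (Sketch.lean L170, conclusion `IsModularGaloisRepTate 5`),
statement verbatim, hypotheses discarded. [cite: BCDTJAMS2001, Introduction (condition (4))] -/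
theorem liftFive_of_tateModularAll (h : TateModularAll) :
    ∀ (W : WeierstrassCurve ℚ) [W.IsElliptic] (ρ : ModPGaloisRep ℚ (ZMod 5) 2),
      W.IsTorsionGaloisRep 5 ρ → ρ.IsAbsIrreducibleOverSqrt 5 → ¬ 25 ∣ W.conductorNorm ℤ →
      ρ.IsModular → W.IsModularGaloisRepTate 5 :=
  fun W _ _ _ _ _ _ ↦ h W 5

/-- Dividend 2 (crux level = STRATEGY-CENSUS road 13, the strategists' call, not this seat's): with
`stub_threeImpTwo` ((4) ⇒ (2), Sketch.lean L186, statement verbatim as hypothesis) the road gives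
`IsModular W` for every elliptic `W/ℚ`, so `stub_modThree` / `stub_switch` become unnecessary for the crux
under a re-composition. [cite: BCDTJAMS2001, Introduction ((4) ⇒ (2))] -/
theorem isModular_of_tateModularAll_of_threeImpTwo (h : TateModularAll)
    (h32 : ∀ (W : WeierstrassCurve ℚ) [W.IsElliptic] [NeZero (W.conductorNorm ℤ)] (ℓ : ℕ) [Fact ℓ.Prime],
      W.IsModularGaloisRepTate ℓ → BCDT.IsModular W)
    (W : WeierstrassCurve ℚ) [W.IsElliptic] [NeZero (W.conductorNorm ℤ)] : BCDT.IsModular W :=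
  h32 W 3 (h W 3)

/-! ## §4 Tree-match certificates (PROVED): the road's pieces exist with the cited shapes -/

/-- The tree's Serre (3.3.1)-input theorem, instantiated: its `hKW` binder IS `KWLarge`'s body and its
conclusion IS `SerreInputConclusion` minus the bad-prime conjunct (certificate that H18.3 is a clone,
not a new theorem). [cite: Serre1987, §4.6, Lemme 5] -/
theorem serreInput_without_badPrimes_of_tree (W : WeierstrassCurve ℚ) [W.IsElliptic] (p₀ : ℕ)
    (hKW : ∀ (p : ℕ) [Fact p.Prime], p₀ ≤ p →
      ∀ (k : Type) [Field k] [TopologicalSpace k] [DiscreteTopology k], khare_wintenberger p k)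
    (hwt : ∀ (p : ℕ) [Fact p.Prime], p₀ ≤ p →
      ∀ ρ : ModPGaloisRep ℚ (ZMod p) 2, W.IsTorsionGaloisRep p ρ →
        ∀ (k : Type) [Field k] [TopologicalSpace k] [DiscreteTopology k] [CharP k p]
          [IsAlgClosed k] (j : ZMod p →+* k)
          (loc : LocalRestrictionAt p (FramedRep.baseChange j continuous_of_discreteTopology ρ))
          (ι : absIntegers 𝒪[loc.F] loc.F ⧸ absMaximalIdeal loc.F →+* k),
          serreWeight p (FramedRep.baseChange j continuous_of_discreteTopology ρ) loc ι = 2)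
    (hlev : ∀ (p : ℕ) [Fact p.Prime], p₀ ≤ p →
      ∀ ρ : ModPGaloisRep ℚ (ZMod p) 2, W.IsTorsionGaloisRep p ρ →
        ∀ (k : Type) [Field k] [TopologicalSpace k] [DiscreteTopology k] [CharP k p]
          [IsAlgClosed k] (j : ZMod p →+* k),
          serreLevel p (FramedRep.baseChange j continuous_of_discreteTopology ρ) ∣
            W.conductorNorm ℤ) :
    ∃ p₁ : ℕ, ∀ (p : ℕ) [Fact p.Prime], p₁ ≤ p →
      ∀ ρ : ModPGaloisRep ℚ (ZMod p) 2, W.IsTorsionGaloisRep p ρ →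
        ∃ (N : ℕ) (_ : NeZero N) (_ : N ≤ W.conductorNorm ℤ) (f : CuspForm (Gamma1 N) 2)
          (K : Type) (_ : Field K) (_ : CharP K p) (_ : TopologicalSpace K)
          (j : ZMod p →+* K) (ι : coeffCharIntegers f →+* K),
          IsNewform1 f ∧
            IsGaloisRepOfNewform1Int f ι {q | q ∣ N * p}
              (FramedRep.baseChange j continuous_of_discreteTopology ρ) :=
  forall_isTorsionGaloisRep_exists_isNewform1_of_khare_wintenberger W p₀ hKW hwt hlev

/-- The additive half of "bad primes divide the level" is a tree theorem (certificate for H18.3).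
[cite: Serre1987, §1.2] -/
theorem additive_dvd_level_of_tree (W : WeierstrassCurve ℚ) [W.IsElliptic] {p : ℕ} [Fact p.Prime]
    (hp3 : 3 ≤ p) {ρ : ModPGaloisRep ℚ (ZMod p) 2} (hρ : W.IsTorsionGaloisRep p ρ)
    {k : Type} [Field k] [TopologicalSpace k] (j : ZMod p →+* k) (hj : Continuous j)
    {M : ℕ} [NeZero M] {f : CuspForm (Gamma1 M) 2} {ιf : coeffCharIntegers f →+* k}
    (hgal : IsGaloisRepOfNewform1Int f ιf {ℓ | ℓ ∣ M * p} (FramedRep.baseChange j hj ρ))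
    {q : ℕ} (hq : q.Prime) (hqp : q ≠ p)
    (hng : ¬ (haveI := Fact.mk hq; W.HasGoodReductionAtPrime q))
    (hnm : ¬ (haveI := Fact.mk hq; W.HasMultiplicativeReductionAtPrime q)) : q ∣ M :=
  W.dvd_of_isGaloisRepOfNewform1Int_of_hasAdditiveReductionAt hp3 hρ j hj hgal hq hqp hng hnm

/-- The local multiplicative lemma behind H18.1a is a tree theorem (certificate).
[cite: SilvermanATAEC1994, Exercise 5.13 (b)] -/
theorem ramMult_local_of_tree (W : WeierstrassCurve ℚ) [W.IsElliptic] {v : HeightOneSpectrum (𝓞 ℚ)}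
    (hmult : W.HasMultiplicativeReductionAt v) {p : ℕ} (hp : p.Prime) (hpv : (p : 𝓞 ℚ) ∉ v.asIdeal)
    (hnd : ¬ p ∣ W.ordMinimalDiscriminant v)
    {w : Valuation (AlgebraicClosure (v.adicCompletion ℚ)) NNReal}
    (hw : ∀ x, (w x : ℝ) = spectralNorm (v.adicCompletion ℚ) (AlgebraicClosure (v.adicCompletion ℚ)) x)
    {𝔐 : Ideal v.localAbsIntegers} (h𝔐 : 𝔐 ∈ v.localPrimesAbove) :
    ∃ σ ∈ 𝔐.inertia (absoluteGaloisGroup (v.adicCompletion ℚ)),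
      ∃ Q : localPoints W (v.adicCompletion ℚ), p • Q = 0 ∧ σ • Q ≠ Q :=
  W.exists_inertia_smul_ne_of_hasMultiplicativeReductionAt_of_not_dvd hmult hp hpv hnd hw h𝔐

/-- The level half that the tree already proves needs no conductor fact (certificate for H18.2).
[cite: Serre1987, §4.6, Lemme 5 (4.6.3)] -/
theorem serreLevel_dvd_conductorNatOf_of_tree {W : WeierstrassCurve ℚ} [W.IsElliptic] {p : ℕ}
    [Fact p.Prime] {ρ : ModPGaloisRep ℚ (ZMod p) 2} (hρ : W.IsTorsionGaloisRep p ρ)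
    {k : Type} [Field k] [TopologicalSpace k] [IsTopologicalRing k] (j : ZMod p →+* k)
    (hj : Continuous j) :
    serreLevel p (ρ.baseChange j hj) ∣
      conductorNatOf (WeierstrassCurve.geomPoints W) p (W.continuous_rationalGaloisRepTate_holds p) :=
  hρ.serreLevel_baseChange_dvd_conductorNatOf j hj _

end Summit.ABC.ABC.Cruxes.FreyModularity.StubIdeas.LiftThree1g18

end
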